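import Summits.ABC.ABC.Theses.DefiniteXi
import Literature.NumberTheory.EllipticCurves.PastenHeightBounds
import Literature.NumberTheory.DiophantineGeometry.GeneralizedFermatTwoPowerCoefficientFreyProofs
import Literature.NumberTheory.DiophantineGeometry.GeneralizedFermatTwoPowerCoefficientSerreProofs
import Literature.NumberTheory.DiophantineGeometry.MinimalDiscriminantFactorizationProofs
import Literature.NumberTheory.EllipticCurves.SzpiroLocalDataProofs
import HarnessLib

/-!
# Crux `DefiniteXi.DefiniteRTControlPrime` (stmt-ABC-11338), line `Sketch` — stub
# `stub_valTransport`: transport of `v_q(Δ_min)` along a `ℚ`-isogeny from a Frey curve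

For coprime `a, b` with `ab(a+b) ≠ 0`, an odd prime `q` of the conductor `N` of the Frey curve
`E = E_(a,b) : y² = x(x − a)(x + b)` and a Weierstrass curve `W'/ℚ` that is `ℚ`-isogenous to `E`,

  `v_q(Δ_min(W')) ≤ 163 · v_q(Δ_min(E))`,

CONDITIONALLY on the named fact `PastenShimura2024_lemma_6_8` (Pasten 2024, Lemma 6.8:
`c_q(E) · n = c_q(W') · m` with `1 ≤ m, n ≤ 163` at a prime `q` of multiplicative reduction of `E`,
`c_q = ord_q Δ_min`), taken as a hypothesis.

Proof: `q ∣ N` and `q ≠ 2` give `q ∣ ab(a+b)` (`dvd_of_dvd_conductorNorm_freyCurve`), so `E` is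
multiplicative at the place `v` over `q` (`hasMultiplicativeReductionAt_freyCurve_of_ne_two`);
Lemma 6.8 yields `c_v(E) · n = c_v(W') · m`, whence `c_v(W') ≤ c_v(W') · m = c_v(E) · n ≤ 163 · c_v(E)`;
finally `c_v = ordMinimalDiscriminant v = (minimalDiscriminantNorm ℤ).factorization q`
(`factorization_minimalDiscriminantNorm_holds`).
-/

-- Summit.<Summit>.<Problem> is the mandated namespace; for the single-conjunct summit ABC the duplicate ABC.ABC is deliberate.
set_option linter.dupNamespace false

noncomputable section

namespace Summit.ABC.ABC.Theorems.DefiniteRTControlPrime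

open Literature.NumberTheory.EllipticCurves Literature.NumberTheory.EllipticCurves.ModularForms
open WeierstrassCurve

/-- **Valuation transport along a `ℚ`-isogeny from a Frey curve** (conditional on Pasten 2024,
Lemma 6.8, taken as the hypothesis `PastenShimura2024_lemma_6_8`): for coprime `a, b` with
`ab(a+b) ≠ 0`, an odd prime `q` dividing the conductor of `E = freyCurve a b`, and `W'`
`ℚ`-isogenous to `E`, the exponent of `q` in `|Δ_min(W')|` is at most `163` times the exponent of
`q` in `|Δ_min(E)|`.  (`E` is multiplicative at `q`, so Lemma 6.8 gives
`c_q(E) · n = c_q(W') · m` with `1 ≤ m, n ≤ 163`.) [cite: PastenShimura2024, Lemma 6.8 (p. 22)] -/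
theorem stub_valTransport : PastenShimura2024_lemma_6_8 →
    ∀ (a b : ℤ), IsCoprime a b → a * b * (a + b) ≠ 0 → ∀ q : ℕ, q.Prime → q ≠ 2 →
      q ∣ (freyCurve a b).conductorNorm ℤ →
      ∀ (W' : WeierstrassCurve ℚ) [W'.IsElliptic], (freyCurve a b).IsIsogenous W' →
        (W'.minimalDiscriminantNorm ℤ).factorization q ≤
          163 * ((freyCurve a b).minimalDiscriminantNorm ℤ).factorization q := by
  intro h68 a b hab h0 q hq hq2 hqN W' _ hiso
  haveI := isElliptic_freyCurve h0
  -- the place of `ℤ` over `q`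
  obtain ⟨v, hv⟩ :
      ∃ v : IsDedekindDomain.HeightOneSpectrum ℤ, Rat.HeightOneSpectrum.natGenerator v = q :=
    ⟨(Rat.HeightOneSpectrum.primesEquiv (R := ℤ)).symm ⟨q, hq⟩,
      Rat.natGenerator_primesEquiv_symm ⟨q, hq⟩⟩
  -- `q ∣ ab(a+b)`, so `E` is multiplicative at `v`
  have hdvd : (q : ℤ) ∣ a * b * (a + b) :=
    Literature.NumberTheory.DiophantineGeometry.dvd_of_dvd_conductorNorm_freyCurve hab h0 hq hq2 hqN
  have hmult : (freyCurve a b).HasMultiplicativeReductionAt v :=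
    Literature.NumberTheory.DiophantineGeometry.hasMultiplicativeReductionAt_freyCurve_of_ne_two
      hab h0 v (hv ▸ hq2) (hv ▸ hdvd)
  -- Pasten's Lemma 6.8 at `v`
  obtain ⟨m, n, hm0, -, -, hn, hmn⟩ := h68 (freyCurve a b) W' hiso v hmult
  -- `ord_v Δ_min = v_q |Δ_min|`
  have h1 := factorization_minimalDiscriminantNorm_holds (freyCurve a b) v
  have h2 := factorization_minimalDiscriminantNorm_holds W' v
  rw [hv] at h1 h2
  rw [h1, h2]
  calc W'.ordMinimalDiscriminant v
      ≤ W'.ordMinimalDiscriminant v * m := Nat.le_mul_of_pos_right _ hm0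
    _ = (freyCurve a b).ordMinimalDiscriminant v * n := hmn.symm
    _ ≤ (freyCurve a b).ordMinimalDiscriminant v * 163 := Nat.mul_le_mul_left _ hn
    _ = 163 * (freyCurve a b).ordMinimalDiscriminant v := Nat.mul_comm _ _

end Summit.ABC.ABC.Theorems.DefiniteRTControlPrime

end
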